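import Summits.Ventures.PercRepro.C026HubPair

/-!
# Hub-pair graphs, IX: the two nets on the same marks, a kernel-checked instance (p5, gen 11)

mine-3's smallest hub-pair graph outside every previously landed family (§25.1): two copies of the
«net» `{a4, c3, b3, b4, 34}` on the same marks — seven vertices `a = 0, b = 1, c = 2` and the two
partner pairs `{3, 4}`, `{5, 6}`, ten edges; every mark has a non-hub neighbour and the graph has
cycles.  `twoNets_isHubPair` is checked by `decide` and **`c026_twoNets`** is C-026 at every `p` on it,
an instance of `c026_hubPair`.
-/

namespace PercRepro

namespace MultiGraph

/-- The two nets on the same marks: vertices `Fin 7` (marks `0, 1, 2`, pairs `{3, 4}`, `{5, 6}`),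
edges `a4, c3, b3, b4, 34, a6, c5, b5, b6, 56`. -/
def twoNets : MultiGraph (Fin 7) (Fin 10) :=
  ⟨![0, 2, 1, 1, 3, 0, 2, 1, 1, 5], ![4, 3, 3, 4, 4, 6, 5, 5, 6, 6]⟩

/-- The two nets form a hub-pair graph (every non-mark has exactly one non-mark neighbour). -/
theorem twoNets_isHubPair : twoNets.IsHubPairGraph 0 1 2 := by
  unfold IsHubPairGraph Joins twoNets
  decide +kernel

/-- **C-026 at every `p` on the two nets**: `P(a~b)·P(c ≁ {a,b}) ≤ P(one pair)` for every
`p ∈ [0,1]^10`, an instance of `c026_hubPair`. -/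
theorem c026_twoNets (p : Fin 10 → ℝ) (hp : IsProb p) :
    (twoNets.law3 p 0 1 2 0 + twoNets.law3 p 0 1 2 1) *
        (twoNets.law3 p 0 1 2 1 + twoNets.law3 p 0 1 2 4) ≤
      twoNets.law3 p 0 1 2 1 + twoNets.law3 p 0 1 2 2 + twoNets.law3 p 0 1 2 3 :=
  c026_hubPair twoNets twoNets_isHubPair p hp

end MultiGraph

end PercRepro
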